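import Summits.BirchSwinnertonDyer.BirchSwinnertonDyer.Theorems.ManinLocalTwoThreePrimeClassGenerationThreeMatrices
import HarnessLib

/-!
# Route `ManinLocalTwoThree`, crux C2 `ManinOddAtFour` (stmt-BirchSwinnertonDyer-22967), line `kato-shift-two`
# (es g7): the span of the MULTI-SHIFT CLASSES over admissible primes `ℓ ≥ ℓ₀` is PRIME-FREE and `ℓ₀`-FREE — it is
# the span of the column elements `Σ_{T ⊆ Gen(N)} (−1)^{|T|} ({∞, b∏T/d}_f − {∞, 0}_f)` over ALL second columns
# `(b, d)` of `Γ₀(N)` (line prover p3; helper, unconditional)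

In E-es-22 `MultiShiftClassGenerationTwo` (leaf `KatoShiftTwoLaws`, stub `stub_multiShiftClass_generation`) the
multi-shift classes `Σ_{T ⊆ Gen(N)} (−1)^{|T|} {0, a∏T/ℓ}_f` (`Gen(N) = {8} ∪ {q ∥ N}`) are indexed by the ADMISSIBLE
primes `ℓ ≥ ℓ₀` (`ℓ ∤ N`, `ℓ ≡ 3 (mod 4)`, no `t ∈ Gen(N)` congruent to `±1 mod ℓ`) and `0 < a < ℓ`.  Here we prove,
for `4 ∣ N` and EVERY `ℓ₀`, that the subgroup of `ℂ` they generate is the subgroup generated by the elements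
`Σ_{T ⊆ Gen(N)} (−1)^{|T|} ({∞, b∏T/d}_f − {∞, 0}_f)` over all integers `b, d` with `d ≠ 0`, `gcd(d, Nb) = 1` — no
primes, no `ℓ₀`:
* `modularSymbol_div_eq_div_add_mul` — `{∞, β/d}_f = {∞, β/(d + Nkβ)}_f` (the parabolic `(1 0; Nk 1) ∈ Γ₀(N)` maps
  `β/d ↦ β/(Nkβ + d)` and has period `0`);
* `multiShiftSpan_admissible_eq_closure_columns` — the equality of spans (`⊆`: an admissible prime class is a column
  element with `d = ℓ`; `⊇`: Dirichlet's theorem in the progression `d + N·|b|·∏_{t ∈ Gen(N)} t · ℤ` gives ONE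
  admissible prime `ℓ ≥ ℓ₀` with `{∞, b∏T/d} = {∞, b∏T/ℓ}` for every `T ⊆ Gen(N)` simultaneously);
* `multiShiftSpan_admissible_eq_of_le` — hence the span does not depend on `ℓ₀` (cofinality in E-es-22 is free:
  REFUTER-ref1 §R38's remark on the `∀ ℓ₀` shape is resolved — the `ℓ₀`-form and the `ℓ₀ = 0` form coincide).
The conjectural content of E-es-22 is thus a statement about the `ℤ`-span of explicit modular-symbol combinations
indexed by the second columns of `Γ₀(N)` — the shape in which an Ihara-type argument on `Γ₀(N)` applies.
Nothing about BSD, Manin's conjecture or E-es-22 itself is proved here.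
-/

set_option autoImplicit false
set_option linter.dupNamespace false

noncomputable section

open scoped Classical MatrixGroups ModularForm BigOperators

open CongruenceSubgroup Matrix.SpecialLinearGroup ModularGroup
  Literature.NumberTheory.EllipticCurves Literature.NumberTheory.EllipticCurves.ModularForms

namespace Summit.BirchSwinnertonDyer.BirchSwinnertonDyer.Theorems.ManinLocalTwoThree

section Columns

variable {N : ℕ} [NeZero N] (f : CuspForm (Gamma0 N) 2)

/-- **`{∞, β/d}_f = {∞, β/(d + Nkβ)}_f`** (`d ≠ 0`, `d + Nkβ ≠ 0`): the parabolic matrix `(1 0; Nk 1) ∈ Γ₀(N)` maps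
the cusp `β/d` to `β/(Nkβ + d)` and has period `{∞, 0/1} − {∞, 0} = 0` (Manin relation
`modularSymbol_gamma0_smul_holds`). [cite: Manin1972, Prop. 1.4 / Thm. 1.6] -/
theorem modularSymbol_div_eq_div_add_mul (β d k : ℤ) (hd : d ≠ 0) (hd' : d + N * k * β ≠ 0) :
    modularSymbol f ((β : ℚ) / d) = modularSymbol f ((β : ℚ) / ((d + N * k * β : ℤ) : ℚ)) := by
  obtain ⟨δ, h00, h01, h10, h11⟩ : ∃ δ : Gamma0 N, ((δ : SL(2, ℤ)) 0 0 : ℤ) = 1 ∧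
      ((δ : SL(2, ℤ)) 0 1 : ℤ) = 0 ∧ ((δ : SL(2, ℤ)) 1 0 : ℤ) = N * k ∧ ((δ : SL(2, ℤ)) 1 1 : ℤ) = 1 := by
    let M : Matrix (Fin 2) (Fin 2) ℤ := !![1, 0; (N : ℤ) * k, 1]
    have hdet : M.det = 1 := by
      rw [Matrix.det_fin_two_of]
      ring
    let δ₀ : SL(2, ℤ) := ⟨M, hdet⟩
    have hmem : δ₀ ∈ Gamma0 N := by
      rw [Gamma0_mem]
      show ((((N : ℤ) * k : ℤ)) : ZMod N) = 0
      push_cast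
      simp
    exact ⟨⟨δ₀, hmem⟩, rfl, rfl, rfl, rfl⟩
  have hδ : cuspSymbol f δ = 0 := by
    rw [cuspSymbol_eq_modularSymbol_div_sub f δ (by rw [h11]; exact one_ne_zero), h01, h11]
    simp
  have hdQ : (d : ℚ) ≠ 0 := by exact_mod_cast hd
  have hd'Q : ((d + N * k * β : ℤ) : ℚ) ≠ 0 := by exact_mod_cast hd'
  have hr : (((δ : SL(2, ℤ)) 1 0 : ℤ) : ℚ) * ((β : ℚ) / d) + (((δ : SL(2, ℤ)) 1 1 : ℤ) : ℚ) ≠ 0 := by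
    rw [h10, h11]
    intro h0
    apply hd'Q
    have : (((N : ℤ) * k : ℤ) : ℚ) * ((β : ℚ) / d) + ((1 : ℤ) : ℚ) = ((d + N * k * β : ℤ) : ℚ) / d := by
      push_cast
      field_simp
      ring
    rw [this] at h0
    rcases div_eq_zero_iff.mp h0 with h | h
    · exact h
    · exact absurd h hdQ
  have key := modularSymbol_gamma0_smul_holds f δ ((β : ℚ) / d) hr
  rw [hδ, zero_add, h00, h01, h10, h11] at key
  rw [← key]
  congr 1
  push_cast
  field_simp
  ring

/-- **The multi-shift span is prime-free and `ℓ₀`-free.** For `4 ∣ N` and every `ℓ₀`, the subgroup of `ℂ` generated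
by the multi-shift classes `Σ_{T ⊆ Gen(N)} (−1)^{|T|} ({∞, a∏T/ℓ}_f − {∞, 0}_f)` over E-es-22's admissible primes
`ℓ ≥ ℓ₀` and `0 < a < ℓ` (index set verbatim) equals the subgroup generated by the column elements
`Σ_{T ⊆ Gen(N)} (−1)^{|T|} ({∞, b∏T/d}_f − {∞, 0}_f)` over all `b d : ℤ` with `d ≠ 0` and `gcd(d, Nb) = 1` (the second
columns of `Γ₀(N)`). [folklore] -/
theorem multiShiftSpan_admissible_eq_closure_columns (h4 : 2 ^ 2 ∣ N) (ℓ₀ : ℕ) :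
    AddSubgroup.closure
      {z : ℂ | ∃ ℓ ∈ {ℓ : ℕ | ℓ₀ ≤ ℓ ∧ (ℓ.Prime ∧ ¬ ℓ ∣ N ∧ ℓ % 4 = 3 ∧
          ∀ t ∈ insert 8 (N.primeFactors.filter fun q => ¬ q ^ 2 ∣ N),
            (t : ZMod ℓ) ≠ 1 ∧ (t : ZMod ℓ) ≠ -1)},
        ∃ a : ℕ, 0 < a ∧ a < ℓ ∧
          z = ∑ T ∈ (insert 8 (N.primeFactors.filter fun q => ¬ q ^ 2 ∣ N)).powerset,
                (-1 : ℂ) ^ T.card *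
                  (modularSymbol f (((a * ∏ t ∈ T, t : ℕ) : ℚ) / ℓ) - modularSymbol f 0)} =
    AddSubgroup.closure
      {z : ℂ | ∃ b d : ℤ, d ≠ 0 ∧ IsCoprime d (N * b) ∧
          z = ∑ T ∈ (insert 8 (N.primeFactors.filter fun q => ¬ q ^ 2 ∣ N)).powerset,
                (-1 : ℂ) ^ T.card *
                  (modularSymbol f (((b * ∏ t ∈ T, (t : ℤ) : ℤ) : ℚ) / d) - modularSymbol f 0)} := by
  have hN0 : 0 < N := Nat.pos_of_ne_zero (NeZero.ne N)
  have h4' : 4 ∣ N := by norm_num at h4; exact h4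
  set G : Finset ℕ := insert 8 (N.primeFactors.filter fun q => ¬ q ^ 2 ∣ N) with hG
  apply le_antisymm
  · -- `⊆`: an admissible prime class is a column element with `d = ℓ`, `b = a`
    rw [AddSubgroup.closure_le]
    rintro z ⟨ℓ, ⟨-, hℓp, hℓN, -, -⟩, a, ha0, ha, rfl⟩
    apply AddSubgroup.subset_closure
    refine ⟨a, ℓ, by exact_mod_cast hℓp.ne_zero, ?_, ?_⟩
    · have hℓa : ¬ ℓ ∣ a := fun h => absurd (Nat.le_of_dvd ha0 h) (not_le.mpr ha)
      refine IsCoprime.mul_right ?_ ?_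
      · rw [Int.isCoprime_iff_gcd_eq_one, Int.gcd_natCast_natCast]
        exact (Nat.Prime.coprime_iff_not_dvd hℓp).mpr hℓN
      · rw [Int.isCoprime_iff_gcd_eq_one, Int.gcd_natCast_natCast]
        exact (Nat.Prime.coprime_iff_not_dvd hℓp).mpr hℓa
    · refine Finset.sum_congr rfl fun T _ => ?_
      push_cast
      ring_nf
  · -- `⊇`: one Dirichlet prime realises all `2^{|Gen|}` classes of a column at once
    rw [AddSubgroup.closure_le]
    rintro z ⟨b, d, hd0, hcop, rfl⟩
    -- trivial column `b = 0`
    by_cases hb0 : b = 0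
    · have : ∑ T ∈ G.powerset, (-1 : ℂ) ^ T.card *
          (modularSymbol f (((b * ∏ t ∈ T, (t : ℤ) : ℤ) : ℚ) / d) - modularSymbol f 0) = 0 := by
        refine Finset.sum_eq_zero fun T _ => ?_
        rw [hb0]
        simp
      rw [SetLike.mem_coe, this]
      exact zero_mem _
    -- basic coprimalities
    have hcopN : IsCoprime d (N : ℤ) := hcop.of_mul_right_left
    have hcopb : IsCoprime d b := hcop.of_mul_right_right
    have two_not_unit : ¬ IsUnit (2 : ℤ) := by
      intro h; rcases Int.isUnit_iff.mp h with h | h <;> norm_num at h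
    have hdodd : d % 2 = 1 := by
      by_contra h0
      have h2d : (2 : ℤ) ∣ d := by omega
      have h2N : (2 : ℤ) ∣ (N : ℤ) := dvd_trans (by norm_num) (by exact_mod_cast h4' : (4 : ℤ) ∣ (N : ℤ))
      exact two_not_unit (hcopN.isUnit_of_dvd' h2d h2N)
    -- sign normalisation: `(−b, −d)` gives the same element, so we may assume `d ≡ 3 (mod 4)`
    suffices key : ∀ b d : ℤ, b ≠ 0 → d % 4 = 3 → IsCoprime d (N * b) →
        (∑ T ∈ G.powerset, (-1 : ℂ) ^ T.card *
          (modularSymbol f (((b * ∏ t ∈ T, (t : ℤ) : ℤ) : ℚ) / d) - modularSymbol f 0)) ∈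
        AddSubgroup.closure
          {z : ℂ | ∃ ℓ ∈ {ℓ : ℕ | ℓ₀ ≤ ℓ ∧ (ℓ.Prime ∧ ¬ ℓ ∣ N ∧ ℓ % 4 = 3 ∧
              ∀ t ∈ G, (t : ZMod ℓ) ≠ 1 ∧ (t : ZMod ℓ) ≠ -1)},
            ∃ a : ℕ, 0 < a ∧ a < ℓ ∧ z = ∑ T ∈ G.powerset, (-1 : ℂ) ^ T.card *
              (modularSymbol f (((a * ∏ t ∈ T, t : ℕ) : ℚ) / ℓ) - modularSymbol f 0)} by
      by_cases h3 : d % 4 = 3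
      · exact key b d hb0 h3 hcop
      · have h1 : (-d) % 4 = 3 := by omega
        have e : (∑ T ∈ G.powerset, (-1 : ℂ) ^ T.card *
            (modularSymbol f (((b * ∏ t ∈ T, (t : ℤ) : ℤ) : ℚ) / d) - modularSymbol f 0)) =
            ∑ T ∈ G.powerset, (-1 : ℂ) ^ T.card *
              (modularSymbol f ((((-b) * ∏ t ∈ T, (t : ℤ) : ℤ) : ℚ) / ((-d : ℤ) : ℚ)) -
                modularSymbol f 0) := by
          refine Finset.sum_congr rfl fun T _ => ?_
          push_cast
          rw [neg_mul, neg_div_neg_eq]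
        rw [SetLike.mem_coe, e]
        exact key (-b) (-d) (neg_ne_zero.mpr hb0) h1 (by rw [mul_neg]; exact hcop.neg_neg)
    -- the main case
    intro b d hb0 hd3 hcop
    have hcopN : IsCoprime d (N : ℤ) := hcop.of_mul_right_left
    have hcopb : IsCoprime d b := hcop.of_mul_right_right
    -- the modulus `Q = N |b| Π`, `Π = ∏_{t ∈ G} t`
    set Pg : ℕ := ∏ t ∈ G, t with hPg
    have hPgdvd : Pg ∣ (8 * N) ^ G.card := by
      rw [hPg, ← Finset.prod_const]
      refine Finset.prod_dvd_prod_of_dvd _ _ fun t ht => ?_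
      rcases Finset.mem_insert.mp ht with rfl | ht'
      · exact dvd_mul_right 8 N
      · exact dvd_trans (Nat.dvd_of_mem_primeFactors (Finset.mem_filter.mp ht').1) ⟨8, by ring⟩
    have hPg0 : Pg ≠ 0 := by
      rw [hPg]
      refine Finset.prod_ne_zero_iff.mpr fun t ht => ?_
      rcases Finset.mem_insert.mp ht with rfl | ht'
      · norm_num
      · exact (Nat.prime_of_mem_primeFactors (Finset.mem_filter.mp ht').1).ne_zero
    have hcop2 : IsCoprime d (2 : ℤ) := ⟨1, -(d / 2), by omega⟩
    have hcop8N : IsCoprime d ((8 * N : ℕ) : ℤ) := by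
      push_cast
      exact ((hcop2.mul_right hcop2).mul_right hcop2).mul_right hcopN |>.of_isCoprime_of_dvd_right
        ⟨1, by ring⟩
    have hcopPg : IsCoprime d (Pg : ℤ) :=
      (hcop8N.pow_right (n := G.card)).of_isCoprime_of_dvd_right (by exact_mod_cast hPgdvd)
    set Q : ℕ := N * b.natAbs * Pg with hQ
    have hQ0 : Q ≠ 0 := mul_ne_zero (mul_ne_zero (NeZero.ne N) (Int.natAbs_ne_zero.mpr hb0)) hPg0
    have hQabs : (Q : ℤ) = N * |b| * Pg := by
      rw [hQ]
      push_cast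
      ring
    have hcopQ : IsCoprime d (Q : ℤ) := by
      rw [hQabs]
      refine (hcopN.mul_right ?_).mul_right hcopPg
      rcases abs_choice b with h | h
      · rw [h]; exact hcopb
      · rw [h]; exact hcopb.neg_right
    obtain ⟨ℓ, hℓn, hℓp, hℓd⟩ := Nat.forall_exists_prime_gt_and_zmodEq (ℓ₀ + N + 9) hQ0 hcopQ
    obtain ⟨m, hm⟩ := Int.modEq_iff_dvd.mp hℓd
    -- hm : d - ℓ = Q * m
    haveI : NeZero ℓ := ⟨hℓp.ne_zero⟩
    have hℓ0 : (ℓ : ℤ) ≠ 0 := by exact_mod_cast hℓp.ne_zero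
    -- `ℓ = d + N k_T (b ∏T)` for every `T ⊆ G`
    have hprog : ∀ T ∈ G.powerset, ∃ k : ℤ, (ℓ : ℤ) = d + N * k * (b * ∏ t ∈ T, (t : ℤ)) := by
      intro T hT
      have hTG : T ⊆ G := Finset.mem_powerset.mp hT
      obtain ⟨s, hs⟩ : ∃ s : ℤ, |b| = s * b := by
        rcases abs_choice b with h | h
        · exact ⟨1, by rw [h]; ring⟩
        · exact ⟨-1, by rw [h]; ring⟩
      refine ⟨-(m * s * ∏ t ∈ G \ T, (t : ℤ)), ?_⟩
      have hsplit : (∏ t ∈ G \ T, (t : ℤ)) * ∏ t ∈ T, (t : ℤ) = ∏ t ∈ G, (t : ℤ) :=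
        Finset.prod_sdiff hTG
      have hPgZ : (Pg : ℤ) = ∏ t ∈ G, (t : ℤ) := by rw [hPg]; push_cast; rfl
      have : (ℓ : ℤ) = d - Q * m := by linear_combination -hm
      rw [this, hQabs, hs, hPgZ, ← hsplit]
      ring
    -- each class of the column equals the class at the prime `ℓ`
    set a : ℕ := (b : ZMod ℓ).val with ha
    have hbmod : ((a : ℕ) : ℤ) = b % ℓ := by rw [ha]; exact ZMod.val_intCast b
    have hterm : ∀ T ∈ G.powerset,
        modularSymbol f (((b * ∏ t ∈ T, (t : ℤ) : ℤ) : ℚ) / d) =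
          modularSymbol f (((a * ∏ t ∈ T, t : ℕ) : ℚ) / ℓ) := by
      intro T hT
      obtain ⟨k, hk⟩ := hprog T hT
      have hd0' : d ≠ 0 := by
        intro h0; rw [h0] at hd3; norm_num at hd3
      rw [modularSymbol_div_eq_div_add_mul f (b * ∏ t ∈ T, (t : ℤ)) d k hd0' (by rw [← hk]; exact hℓ0), ← hk]
      -- shift the numerator by the integer `-(b / ℓ) * ∏ t`
      have hshift : (((a * ∏ t ∈ T, t : ℕ)) : ℚ) / ℓ =
          (((b * ∏ t ∈ T, (t : ℤ) : ℤ)) : ℚ) / ((ℓ : ℤ) : ℚ) + ((-(b / ℓ) * ∏ t ∈ T, (t : ℤ) : ℤ) : ℚ) := by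
        have hℓQ : (ℓ : ℚ) ≠ 0 := by exact_mod_cast hℓp.ne_zero
        have haZ : ((a : ℕ) : ℤ) = b - ℓ * (b / ℓ) := by rw [hbmod, Int.emod_def]
        have haQ : ((a : ℕ) : ℚ) = (b : ℚ) - (ℓ : ℚ) * ((b / ℓ : ℤ) : ℚ) := by exact_mod_cast haZ
        push_cast
        rw [haQ]
        field_simp
        ring
      rw [hshift, modularSymbol_add_intCast_holds f]
    have hsum : (∑ T ∈ G.powerset, (-1 : ℂ) ^ T.card *
        (modularSymbol f (((b * ∏ t ∈ T, (t : ℤ) : ℤ) : ℚ) / d) - modularSymbol f 0)) =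
        ∑ T ∈ G.powerset, (-1 : ℂ) ^ T.card *
          (modularSymbol f (((a * ∏ t ∈ T, t : ℕ) : ℚ) / ℓ) - modularSymbol f 0) :=
      Finset.sum_congr rfl fun T hT => by rw [hterm T hT]
    rw [hsum]
    -- `0 < a` : `ℓ ∤ b`
    have ha0 : 0 < a := by
      rw [Nat.pos_iff_ne_zero, ha, ne_eq, ZMod.val_eq_zero]
      intro h0
      have hdvd : (ℓ : ℤ) ∣ b := (ZMod.intCast_zmod_eq_zero_iff_dvd b ℓ).mp h0
      obtain ⟨k, hk⟩ := hprog ∅ (Finset.empty_mem_powerset G)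
      simp only [Finset.prod_empty, mul_one] at hk
      have hcopℓ : IsCoprime (ℓ : ℤ) b := by
        rw [hk]
        exact hcopb.add_mul_right_left (N * k)
      have hu : IsUnit (ℓ : ℤ) := hcopℓ.isUnit_of_dvd' (dvd_refl _) hdvd
      rcases Int.isUnit_iff.mp hu with h1 | h1
      · exact hℓp.one_lt.ne' (by exact_mod_cast h1)
      · have : (0 : ℤ) ≤ (ℓ : ℤ) := by positivity
        omega
    -- admissibility of `ℓ`
    have hℓ4 : ℓ % 4 = 3 := by
      obtain ⟨k, hk⟩ := hprog ∅ (Finset.empty_mem_powerset G)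
      simp only [Finset.prod_empty, mul_one] at hk
      have h4Z : (4 : ℤ) ∣ (N : ℤ) := by exact_mod_cast h4'
      have : (ℓ : ℤ) % 4 = d % 4 := by
        have hmod : (ℓ : ℤ) ≡ d [ZMOD N] := Int.modEq_iff_dvd.mpr ⟨-(k * b), by rw [hk]; ring⟩
        exact hmod.of_dvd h4Z
      omega
    refine AddSubgroup.subset_closure ⟨ℓ, ⟨by omega, hℓp, ?_, hℓ4, ?_⟩, a, ha0, ZMod.val_lt _, rfl⟩
    · exact fun h => absurd (Nat.le_of_dvd hN0 h) (by omega)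
    · intro t ht
      have htb : 2 ≤ t ∧ t + 1 < ℓ := by
        rcases Finset.mem_insert.mp ht with rfl | ht'
        · exact ⟨by norm_num, by omega⟩
        · have hq := (Finset.mem_filter.mp ht').1
          exact ⟨(Nat.prime_of_mem_primeFactors hq).two_le,
            by have := Nat.le_of_dvd hN0 (Nat.dvd_of_mem_primeFactors hq); omega⟩
      refine ⟨fun h1 => ?_, fun h1 => ?_⟩
      · have h := (ZMod.natCast_eq_natCast_iff' t 1 ℓ).mp (by simpa using h1)
        rw [Nat.mod_eq_of_lt (by omega : t < ℓ), Nat.mod_eq_of_lt hℓp.one_lt] at h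
        omega
      · have h : ((t + 1 : ℕ) : ZMod ℓ) = 0 := by
          push_cast
          rw [h1]
          ring
        have hdvd : ℓ ∣ t + 1 := (ZMod.natCast_eq_zero_iff (t + 1) ℓ).mp h
        exact absurd (Nat.le_of_dvd (by omega) hdvd) (by omega)

/-- **The multi-shift span does not depend on `ℓ₀`**: for `4 ∣ N` and `ℓ₀ ≤ ℓ₁`... indeed for ANY `ℓ₀, ℓ₁`, the
multi-shift classes over admissible primes `ℓ ≥ ℓ₀` and over admissible primes `ℓ ≥ ℓ₁` generate the same subgroup
of `ℂ` (both equal the column span, `multiShiftSpan_admissible_eq_closure_columns`). In particular the `∀ ℓ₀`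
(cofinal) form of E-es-22 is equivalent to its `ℓ₀ = 0` instance. [folklore] -/
theorem multiShiftSpan_admissible_eq_of_le (h4 : 2 ^ 2 ∣ N) (ℓ₀ ℓ₁ : ℕ) :
    AddSubgroup.closure
      {z : ℂ | ∃ ℓ ∈ {ℓ : ℕ | ℓ₀ ≤ ℓ ∧ (ℓ.Prime ∧ ¬ ℓ ∣ N ∧ ℓ % 4 = 3 ∧
          ∀ t ∈ insert 8 (N.primeFactors.filter fun q => ¬ q ^ 2 ∣ N),
            (t : ZMod ℓ) ≠ 1 ∧ (t : ZMod ℓ) ≠ -1)},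
        ∃ a : ℕ, 0 < a ∧ a < ℓ ∧
          z = ∑ T ∈ (insert 8 (N.primeFactors.filter fun q => ¬ q ^ 2 ∣ N)).powerset,
                (-1 : ℂ) ^ T.card *
                  (modularSymbol f (((a * ∏ t ∈ T, t : ℕ) : ℚ) / ℓ) - modularSymbol f 0)} =
    AddSubgroup.closure
      {z : ℂ | ∃ ℓ ∈ {ℓ : ℕ | ℓ₁ ≤ ℓ ∧ (ℓ.Prime ∧ ¬ ℓ ∣ N ∧ ℓ % 4 = 3 ∧
          ∀ t ∈ insert 8 (N.primeFactors.filter fun q => ¬ q ^ 2 ∣ N),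
            (t : ZMod ℓ) ≠ 1 ∧ (t : ZMod ℓ) ≠ -1)},
        ∃ a : ℕ, 0 < a ∧ a < ℓ ∧
          z = ∑ T ∈ (insert 8 (N.primeFactors.filter fun q => ¬ q ^ 2 ∣ N)).powerset,
                (-1 : ℂ) ^ T.card *
                  (modularSymbol f (((a * ∏ t ∈ T, t : ℕ) : ℚ) / ℓ) - modularSymbol f 0)} := by
  rw [multiShiftSpan_admissible_eq_closure_columns f h4 ℓ₀,
    multiShiftSpan_admissible_eq_closure_columns f h4 ℓ₁]

end Columns

end Summit.BirchSwinnertonDyer.BirchSwinnertonDyer.Theorems.ManinLocalTwoThree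

end
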